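import Summits.NavierStokesRegularity.FluidComputer.ClayBlowupLocalAlignment
import Summits.NavierStokesRegularity.FluidComputer.ClayBlowupZoomTypeI
import Summits.NavierStokesRegularity.NavierStokesRegularity.Theorems.LiouvilleConjectureNS
import HarnessLib

/-!
# (L) EXCLUDES TYPE I AT EVERY SINGULAR POINT, WITH THE CLAY FORCE: under KNSS's Liouville
# conjecture no singular point of a Clay blow-up carries a LOCAL Type I bound

Cell `ns-blowup`, seat `ns-blowup-ecbridge-2` (g11; the E–C endpoint theory seat). LABEL: E–C typing
(KERNEL — conditional on the tree's `@[conjecture]` `LiouvilleConjectureNS`, taken as an explicit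
hypothesis `hL`; no new definition). WHAT THIS IS NOT: not Navier–Stokes evidence — a necessary
condition on the TYPE `ClayBlowup ν` with its Clay force; no inhabitant is claimed. Companion memo:
`run/shared/lean/pub/ns-blowup/ecbridge2/ECBRIDGE-2-MEMO-10.md`.

## Content

g10's `ClayBlowup.not_typeI_forced_of_liouvilleConjecture` ((L) ⇒ a Clay blow-up, with its force, is
not a Type I blow-up) needs the GLOBAL Type I bound `‖u(t, x)‖ ≤ C/√(T − t)` at all `x`, because its
zoom is centred at global near-maxima. With the LOCAL zoom (`exists_local_zoom_limit`) the hypothesis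
localises to any ball around any one singular point:

* `ClayBlowup.not_localTypeI_one_of_liouvilleConjecture` (`ν = 1`) and
  **`ClayBlowup.not_localTypeI_of_liouvilleConjecture`** (every `ν > 0`) — `LiouvilleConjectureNS →`
  for every point `x₁` which is not backward bounded at `T`, every `r₀ > 0` and every `C`, the bound
  `‖u(t, x)‖ ≤ C/√(T − t)` for `t` near `T` and `x ∈ B(x₁, r₀)` FAILS; `DesignedBlowup` twin.

Proof: the local zoom limit `W` at `x₁` is a nontrivial bounded ancient mild solution of the unforced
equations with the Type I decay `√(−s)‖W(s, z)‖ ≤ C` (the local bound suffices: the physical points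
`x_j + c_j z` enter `B(x₁, r₀)` eventually); (L) makes every slice a.e. constant, hence constant
(continuity), and a spatially constant ancient mild solution with Type I decay vanishes
(`false_of_sliceConst_of_typeI_decay`).

References: Koch–Nadirashvili–Seregin–Šverák, Acta Math. 203 (2009), §1 («(L) would exclude Type I
blow-up»), Prop 6.1 [cite: KochNadirashviliSereginSverak2009, §1 and Prop 6.1]; C. L. Fefferman, (C)
[cite: FeffermanClay2006, (C)].
-/

noncomputable section

namespace Summit.NavierStokesRegularity.FluidComputer

open Set MeasureTheory Filter Topology Function Metric
open scoped ENNReal NNReal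
open Literature.Analysis Literature.Analysis.FluidPDE
open Summit.NavierStokesRegularity.NavierStokesRegularity

namespace ClayBlowup

/-- **(L) EXCLUDES A LOCAL TYPE I BOUND AT EVERY SINGULAR POINT (`ν = 1`, ANY Clay force)**: under
`LiouvilleConjectureNS`, at a point `x₁` which is not backward bounded no bound
`‖u(t, x)‖ ≤ C/√(T − t)` holds for `t` near `T` on a ball `B(x₁, r₀)`. The local zoom with force;
Type I passes to the limit; (L) and `false_of_sliceConst_of_typeI_decay`.
[cite: KochNadirashviliSereginSverak2009, §1 and Prop 6.1] -/
theorem not_localTypeI_one_of_liouvilleConjecture (Y : ClayBlowup 1)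
    (hL : Summit.NavierStokesRegularity.NavierStokesRegularity.LiouvilleConjectureNS)
    {x₁ : EuclideanSpace ℝ (Fin 3)} (hx₁ : ¬ IsBackwardBoundedAt Y.u Y.T x₁) {r₀ : ℝ} (hr₀ : 0 < r₀)
    (C : ℝ) : ¬ ∀ᶠ t in 𝓝[<] Y.T, ∀ x ∈ ball x₁ r₀, ‖Y.u t x‖ ≤ C / Real.sqrt (Y.T - t) := by
  intro hC
  have hT := Y.T_pos
  -- ### the local zoom at `x₁`
  have hr' : 0 < min 1 (r₀ / 2) := lt_min one_pos (by positivity)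
  have ht_b : Y.T / 2 ∈ Ico 0 Y.T := ⟨by positivity, by linarith⟩
  obtain ⟨t, x, φ, W, hφ, ht, hx, hk1, hWc0, hWdiv0, hWmild0, hW4, ⟨σ₁, hσ₁, hhalf⟩, hconv⟩ :=
    Y.exists_local_zoom_limit hx₁ hr' (min_le_left _ _) ht_b
  obtain ⟨c, hc⟩ : ∃ c : ℕ → ℝ, ∀ k, c k = ‖Y.u (t k) (x k)‖⁻¹ := ⟨_, fun k => rfl⟩
  simp_rw [← hc] at hconv
  have hM0 : ∀ k, 0 < ‖Y.u (t k) (x k)‖ := fun k => lt_of_lt_of_le (by positivity) (hk1 k)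
  have hc0 : ∀ k, 0 < c k := fun k => by rw [hc k]; exact inv_pos.2 (hM0 k)
  have htI : ∀ k, t k ∈ Ioo 0 Y.T := fun k => ⟨lt_of_lt_of_le (by positivity) (ht k).1, (ht k).2⟩
  have hxr : ∀ k, dist (x k) x₁ < r₀ / 2 := fun k =>
    lt_of_lt_of_le (mem_ball.1 (hx k)) (min_le_right _ _)
  -- ### slice times → T⁻, amplitudes → 0
  have htT : Tendsto t atTop (𝓝[<] Y.T) := Y.tendsto_of_norm_ge one_pos htI hk1
  have hcto : Tendsto c atTop (𝓝 0) := by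
    have hMto : Tendsto (fun k => ‖Y.u (t k) (x k)‖) atTop atTop := by
      refine tendsto_atTop_atTop.2 fun B => ⟨⌈B⌉₊, fun k hk => ?_⟩
      have h1 : (⌈B⌉₊ : ℝ) ≤ k := by exact_mod_cast hk
      linarith [Nat.le_ceil B, hk1 k]
    exact (tendsto_inv_atTop_zero.comp hMto).congr fun k => by simp [Function.comp, hc k]
  have htime : ∀ s ≤ 0, Tendsto (fun j => t (φ j) + c (φ j) ^ 2 * s) atTop (𝓝[<] Y.T) := by
    intro s hs
    have h1 : Tendsto (fun j => t (φ j)) atTop (𝓝 Y.T) :=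
      (tendsto_nhdsWithin_iff.1 htT).1.comp hφ.tendsto_atTop
    have h2 : Tendsto (fun j => c (φ j) ^ 2 * s) atTop (𝓝 0) := by
      simpa using ((hcto.comp hφ.tendsto_atTop).pow 2).mul_const s
    refine tendsto_nhdsWithin_iff.2 ⟨by simpa using h1.add h2, Eventually.of_forall fun j => ?_⟩
    have : c (φ j) ^ 2 * s ≤ 0 := mul_nonpos_of_nonneg_of_nonpos (sq_nonneg _) hs
    exact lt_of_le_of_lt (by linarith) (ht (φ j)).2
  have hsqrt : ∀ s ≤ 0, ∀ j, c (φ j) * Real.sqrt (-s) ≤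
      Real.sqrt (Y.T - (t (φ j) + c (φ j) ^ 2 * s)) := by
    intro s hs j
    have e1 : c (φ j) * Real.sqrt (-s) = Real.sqrt (c (φ j) ^ 2 * -s) := by
      rw [Real.sqrt_mul (sq_nonneg _), Real.sqrt_sq (hc0 _).le]
    rw [e1]
    refine Real.sqrt_le_sqrt ?_
    have e2 : c (φ j) ^ 2 * -s = -(c (φ j) ^ 2 * s) := by ring
    rw [e2]
    linarith [(ht (φ j)).2]
  have hsmall : ∀ A : ℝ, ∀ᶠ j in atTop, c (φ j) * A < r₀ / 4 := fun A => by
    have h : Tendsto (fun j => c (φ j) * A) atTop (𝓝 (0 * A)) :=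
      (hcto.comp hφ.tendsto_atTop).mul_const A
    rw [zero_mul] at h
    exact h.eventually (gt_mem_nhds (by positivity))
  have hball : ∀ j (z : EuclideanSpace ℝ (Fin 3)), c (φ j) * ‖z‖ < r₀ / 2 →
      x (φ j) + c (φ j) • z ∈ ball x₁ r₀ := by
    intro j z hz
    rw [mem_ball, dist_eq_norm]
    have e : x (φ j) + c (φ j) • z - x₁ = (x (φ j) - x₁) + c (φ j) • z := by abel
    rw [e]
    have h1 : ‖x (φ j) - x₁‖ < r₀ / 2 := by rw [← dist_eq_norm]; exact hxr _
    have h2 : ‖c (φ j) • z‖ < r₀ / 2 := by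
      rwa [norm_smul, Real.norm_of_nonneg (hc0 _).le]
    linarith [norm_add_le (x (φ j) - x₁) (c (φ j) • z)]
  -- ### (1) Type I passes to the limit
  have hIW : ∀ s < 0, ∀ z, Real.sqrt (-s) * ‖W s z‖ ≤ C := by
    intro s hs z
    have hs0 : 0 < Real.sqrt (-s) := Real.sqrt_pos.2 (by linarith)
    refine le_of_tendsto (((hconv s hs z).norm).const_mul _) ?_
    filter_upwards [(htime s hs.le).eventually hC, hsmall ‖z‖] with j hj hjz
    rw [norm_smul, Real.norm_of_nonneg (hc0 (φ j)).le]
    have h1 := hj (x (φ j) + c (φ j) • z) (hball j z (by linarith))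
    have h2 := hsqrt s hs.le j
    have hTt : 0 < Real.sqrt (Y.T - (t (φ j) + c (φ j) ^ 2 * s)) :=
      lt_of_lt_of_le (mul_pos (hc0 _) hs0) h2
    have hC0 : 0 ≤ C := by
      have h0 := (norm_nonneg _).trans h1
      exact (div_nonneg_iff.1 h0).elim (fun h => h.1) fun h => absurd h.2 (not_le.2 hTt)
    have hcφ : 0 ≤ c (φ j) := (hc0 _).le
    calc Real.sqrt (-s) * (c (φ j) * ‖Y.u (t (φ j) + c (φ j) ^ 2 * s) (x (φ j) + c (φ j) • z)‖)
        ≤ Real.sqrt (-s) * (c (φ j) * (C / Real.sqrt (Y.T - (t (φ j) + c (φ j) ^ 2 * s)))) := by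
          gcongr
      _ = C * (c (φ j) * Real.sqrt (-s) / Real.sqrt (Y.T - (t (φ j) + c (φ j) ^ 2 * s))) := by
          ring
      _ ≤ C * 1 := by
          gcongr
          rw [div_le_one hTt]; exact h2
      _ = C := mul_one C
  -- ### (2) the limit is non-trivial, smooth, a bounded ancient mild solution
  have hnt : ∃ s < 0, ∃ z, W s z ≠ 0 := by
    refine ⟨-(σ₁ / 2), by linarith, 0, fun h => ?_⟩
    have h1 := hhalf (-(σ₁ / 2)) ⟨by linarith, by linarith⟩
    rw [h, norm_zero] at h1
    linarith
  obtain ⟨hsm, -⟩ := smooth_and_bounds_of_bounded_ancient_oseenMild hWc0 hWdiv0 hWmild0 hW4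
  have hslice : ∀ s < 0, ContDiff ℝ (⊤ : ℕ∞) (W s) := fun s hs =>
    hsm.comp_contDiff (contDiff_prodMk_right s) fun y => mk_mem_prod (mem_Iio.2 hs) (mem_univ y)
  have hWsc : ∀ s < 0, Continuous (W s) := fun s hs => (hslice s hs).continuous
  have hbam : IsBoundedAncientMildSolution 1 W :=
    isBoundedAncientMildSolution_of_oseen one_pos hWc0 ⟨4, hW4⟩ hWdiv0
      (fun s τ hsτ hτ z => by rw [one_mul]; exact hWmild0 s τ hsτ hτ z)
  -- ### (3) (L): every slice is a.e. constant, hence constant; Type I decay kills constants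
  have hconst : ∀ s < 0, ∀ z, W s z = W s 0 := by
    intro s hs z
    obtain ⟨b, hb⟩ := hL W hbam (fun τ hτ => (hWsc τ hτ).aestronglyMeasurable) s hs
    have heq : W s = fun _ => b := ((hWsc s hs).ae_eq_iff_eq volume continuous_const).1 hb
    rw [heq]
  exact false_of_sliceConst_of_typeI_decay (C := C)
    (fun s hs => (hslice s hs).of_le (by norm_cast)) ⟨4, hW4⟩ hWdiv0 hWmild0 hnt hIW hconst

/-- **(L) EXCLUDES A LOCAL TYPE I BOUND AT EVERY SINGULAR POINT, WITH THE CLAY FORCE** (`μ > 0`, ANY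
Clay force; (L) = `LiouvilleConjectureNS` is a hypothesis): at a point `x₁` which is not backward
bounded at `T`, for every `r₀ > 0` and `C` the bound `‖u(t, x)‖ ≤ C/√(T − t)` for `t` near `T` and
`x ∈ B(x₁, r₀)` fails. Localises g10's `not_typeI_forced_of_liouvilleConjecture` (viscosity
normalisation: `isBackwardBoundedAt_of_rescale`, `eventually_localTypeI_rescale`).
[cite: KochNadirashviliSereginSverak2009, §1 («(L) would exclude Type I blow-up»)] -/
theorem not_localTypeI_of_liouvilleConjecture {μ : ℝ} (X : ClayBlowup μ) (hμ : 0 < μ)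
    (hL : Summit.NavierStokesRegularity.NavierStokesRegularity.LiouvilleConjectureNS)
    {x₁ : EuclideanSpace ℝ (Fin 3)} (hx₁ : ¬ IsBackwardBoundedAt X.u X.T x₁) {r₀ : ℝ} (hr₀ : 0 < r₀)
    (C : ℝ) : ¬ ∀ᶠ t in 𝓝[<] X.T, ∀ x ∈ ball x₁ r₀, ‖X.u t x‖ ≤ C / Real.sqrt (X.T - t) :=
  fun hC =>
    (X.rescale hμ one_pos).not_localTypeI_one_of_liouvilleConjecture hL
      (fun h => hx₁ (X.isBackwardBoundedAt_of_rescale hμ one_pos h)) hr₀ _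
      (X.eventually_localTypeI_rescale hμ one_pos hC)

/-- **Under (L), every singular point is a point of LOCAL Type II growth, with the Clay force**
(`μ > 0`): for every `r₀ > 0`, every `C` and every `t₀ < T` there are `t ∈ (t₀, T)` and
`x ∈ B(x₁, r₀)` with `‖u(t, x)‖ > C/√(T − t)`. [cite: KochNadirashviliSereginSverak2009, §1] -/
theorem exists_gt_typeI_near_of_liouvilleConjecture {μ : ℝ} (X : ClayBlowup μ) (hμ : 0 < μ)
    (hL : Summit.NavierStokesRegularity.NavierStokesRegularity.LiouvilleConjectureNS)
    {x₁ : EuclideanSpace ℝ (Fin 3)} (hx₁ : ¬ IsBackwardBoundedAt X.u X.T x₁) {r₀ : ℝ} (hr₀ : 0 < r₀)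
    (C : ℝ) {t₀ : ℝ} (ht₀ : t₀ < X.T) :
    ∃ t ∈ Ioo t₀ X.T, ∃ x ∈ ball x₁ r₀, C / Real.sqrt (X.T - t) < ‖X.u t x‖ := by
  by_contra hcon
  push Not at hcon
  refine X.not_localTypeI_of_liouvilleConjecture hμ hL hx₁ hr₀ C ?_
  filter_upwards [Ioo_mem_nhdsLT ht₀] with t ht x hx
  exact hcon t ht x hx

end ClayBlowup

/-- **(L) ⇒ no LOCAL Type I bound at any singular point of a designed blow-up, with its force.**
[cite: KochNadirashviliSereginSverak2009, §1] -/
theorem DesignedBlowup.not_localTypeI_of_liouvilleConjecture {ν : ℝ} (D : DesignedBlowup ν)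
    (hν : 0 < ν) (hL : Summit.NavierStokesRegularity.NavierStokesRegularity.LiouvilleConjectureNS)
    {x₁ : EuclideanSpace ℝ (Fin 3)} (hx₁ : ¬ IsBackwardBoundedAt D.u D.T x₁) {r₀ : ℝ} (hr₀ : 0 < r₀)
    (C : ℝ) : ¬ ∀ᶠ t in 𝓝[<] D.T, ∀ x ∈ ball x₁ r₀, ‖D.u t x‖ ≤ C / Real.sqrt (D.T - t) :=
  D.toClayBlowup.not_localTypeI_of_liouvilleConjecture hν hL hx₁ hr₀ C

end Summit.NavierStokesRegularity.FluidComputer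

end
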